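import Mathlib
import HarnessLib
import Summits.ValiantsHypothesis.ValiantsHypothesis.Theorems.MonotoneRestorationOrbitRestorationQPMultiRowColumnProducts

/-!
# Orbit sums of `k`-row patterns AUGMENTED BY THE COLUMN SUMS are orbit-restorable
# (route MonotoneRestoration, crux `OrbitRestorationQP` stmt-ValiantsHypothesis-18293; certified sub-class of the crux containing the
# restoration half of the affine column-set-multilinear stratum of line `depth-three-rung`)

Namespace `Summit.ValiantsHypothesis.ValiantsHypothesis.Theorems.MultiRowColumnProducts`.  Definition-free.

`…MultiRowColumnProducts.lean` / `…MultiRowColumnSymmetric.lean`: `Σ_g Ψ(x_{g(i) b})` is restorable for every column-symmetric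
pattern `Ψ` of a `k × n` submatrix.  The equivariant normal forms of the affine column-set-multilinear stratum
(`SmlAffineRestoration`: `Σ_{β,τ,g} d · Π_b (β + C_b + Σ_i τ_i x_{g_i b})`) also involve the COLUMN SUMS `C_b = Σ_a x_{ab}` — not
supported on the rows `g`, but fixed by every permutation fixing `b`.  Adjoining them as one more "row" of the pattern keeps every
value of the derivation supported on `≤ k + 2` indices:

* `augmentedPowerSum_supported` — the AUGMENTED MULTI-ROW POWER SUMS `A_γ(g) = Σ_b C_b^{γ(inr ⋆)} Π_i x_{g(i) b}^{γ(inl i)}`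
  (`γ : Fin k ⊕ Unit → ℕ`) are fixed by the pointwise stabiliser of the rows of `g` and have `(k+2)`-supported derivations;
* `qpOrbitRestorable_orbitSum_augmented` — equivariant families `Φ g ∈ ℂ[A_γ(g) : γ]` have restorable orbit sums `Σ_g Φ g`
  (`QPOrbitRestorable (2k + 9) n`);
* `aeval_mem_adjoin_augmented`, `ren_aeval_augmentedPattern` — a column-symmetric pattern `Ψ ∈ ℂ[X_{(b,s)} : b < n, s ∈ Fin k ⊕ Unit]`
  evaluated at `X_{(b, inl i)} ↦ x_{g(i) b}`, `X_{(b, inr ⋆)} ↦ C_b` lies in `ℂ[A_γ(g)]`, equivariantly;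
* `qpOrbitRestorable_orbitSum_augmentedPattern` — **`Σ_{g : Fin k → Fin n} Ψ(x_{g(i) b}, C_b)` is `QPOrbitRestorable (2k + 9) n` for every
  column-symmetric augmented pattern `Ψ`.**  Instances: every term family `g ↦ Π_b (β + C_b + Σ_i τ_i x_{g_i b})` of the affine
  equivariant normal form (so the RESTORATION HALF of the affine column-sml stratum is the case "Ψ = a product of affine columns"),
  and non-affine ones such as `Σ_a Π_b (1 + x_{ab} C_b)` (outside depth three).

Honest label: a stratum of the crux class; no stub closed; VP ≠ VNP untouched. [folklore]
[cite: Weyl1939, Chap. II §3, Thm (2.3.A); DawarWilsenach2025, §3.3]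
-/

noncomputable section

open scoped Classical

-- `Summit.ValiantsHypothesis.ValiantsHypothesis.…` is the tree's single-conjunct layout (Sub = Summit).
set_option linter.dupNamespace false

namespace Summit.ValiantsHypothesis.ValiantsHypothesis.Theorems.MultiRowColumnProducts

open MvPolynomial Equiv Literature.Computability.AlgebraicComplexity OrbitRestorationQPDepthThreeRung
  Summit.ValiantsHypothesis.ValiantsHypothesis.Theorems RowColumnTwoLevel

variable {n : ℕ}

/-! ### Augmented multi-row power sums -/

/-- The column sum `C_b` has a `K`-supported derivation for every `K ≥ 2` and is fixed by every permutation fixing `b`. [folklore] -/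
theorem colSum_supported_le {K : ℕ} (hK : 2 ≤ K) (b : Fin n) :
    (∀ σ : Perm (Fin n), σ b = b → ren σ (∑ a : Fin n, (X (a, b) : MvPolynomial (Fin n × Fin n) ℂ)) = ∑ a : Fin n, X (a, b)) ∧
    ∃ 𝒟 : ValueDerivation ℂ (Fin n × Fin n), (∑ a : Fin n, (X (a, b) : MvPolynomial (Fin n × Fin n) ℂ)) ∈ 𝒟.S ∧
      ∀ q ∈ 𝒟.S, ∃ T' : Finset (Fin n), T'.card ≤ K ∧ ∀ σ : Perm (Fin n), (∀ i ∈ T', σ i = i) → ren σ q = q := by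
  obtain ⟨hfix, 𝒟, hmem, hS⟩ := colPowerSum_supported (n := n) b 1
  refine ⟨fun σ hb => ?_, 𝒟, by simpa only [pow_one] using hmem,
    fun q hq => by obtain ⟨T', hT', h⟩ := hS q hq; exact ⟨T', hT'.trans hK, h⟩⟩
  have h := hfix σ (fun j' hj' => by rw [Finset.mem_singleton.1 hj']; exact hb)
  simpa only [pow_one] using h

/-- **Augmented multi-row power sums are supported.**  `A_γ(g) = Σ_b C_b^{γ(inr ⋆)} · Π_i x_{g(i) b}^{γ(inl i)}` is fixed by every
permutation fixing the rows of `g` pointwise and has a `(k+2)`-supported derivation. [folklore] -/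
theorem augmentedPowerSum_supported {k : ℕ} (g : Fin k → Fin n) (γ : Fin k ⊕ Unit → ℕ) :
    (∀ σ : Perm (Fin n), (∀ i ∈ Finset.univ.image g, σ i = i) →
      ren σ (∑ b : Fin n, (∑ a : Fin n, (X (a, b) : MvPolynomial (Fin n × Fin n) ℂ)) ^ γ (Sum.inr ()) *
          ∏ i : Fin k, (X (g i, b) : MvPolynomial (Fin n × Fin n) ℂ) ^ γ (Sum.inl i)) =
        ∑ b : Fin n, (∑ a : Fin n, (X (a, b) : MvPolynomial (Fin n × Fin n) ℂ)) ^ γ (Sum.inr ()) *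
          ∏ i : Fin k, (X (g i, b) : MvPolynomial (Fin n × Fin n) ℂ) ^ γ (Sum.inl i)) ∧
    ∃ 𝒟 : ValueDerivation ℂ (Fin n × Fin n),
      (∑ b : Fin n, (∑ a : Fin n, (X (a, b) : MvPolynomial (Fin n × Fin n) ℂ)) ^ γ (Sum.inr ()) *
          ∏ i : Fin k, (X (g i, b) : MvPolynomial (Fin n × Fin n) ℂ) ^ γ (Sum.inl i)) ∈ 𝒟.S ∧
      ∀ q ∈ 𝒟.S, ∃ T' : Finset (Fin n), T'.card ≤ k + 2 ∧ ∀ σ : Perm (Fin n), (∀ i ∈ T', σ i = i) → ren σ q = q := by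
  have hg_fix : ∀ σ : Perm (Fin n), (∀ i ∈ Finset.univ.image g, σ i = i) → ∀ i : Fin k, σ (g i) = g i :=
    fun σ hσ i => hσ (g i) (Finset.mem_image_of_mem g (Finset.mem_univ i))
  have hC : ∀ (σ : Perm (Fin n)) (b : Fin n),
      ren σ (∑ a : Fin n, (X (a, b) : MvPolynomial (Fin n × Fin n) ℂ)) = ∑ a : Fin n, X (a, σ b) := by
    intro σ b
    rw [map_sum]
    simp only [ren_X, Prod.smul_mk, Perm.smul_def]
    exact Equiv.sum_comp σ (fun a => (X (a, σ b) : MvPolynomial (Fin n × Fin n) ℂ))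
  have hfix : ∀ σ : Perm (Fin n), (∀ i ∈ Finset.univ.image g, σ i = i) →
      ren σ (∑ b : Fin n, (∑ a : Fin n, (X (a, b) : MvPolynomial (Fin n × Fin n) ℂ)) ^ γ (Sum.inr ()) *
          ∏ i : Fin k, (X (g i, b) : MvPolynomial (Fin n × Fin n) ℂ) ^ γ (Sum.inl i)) =
        ∑ b : Fin n, (∑ a : Fin n, (X (a, b) : MvPolynomial (Fin n × Fin n) ℂ)) ^ γ (Sum.inr ()) *
          ∏ i : Fin k, (X (g i, b) : MvPolynomial (Fin n × Fin n) ℂ) ^ γ (Sum.inl i) := by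
    intro σ hσ
    rw [map_sum]
    simp only [map_mul, map_pow, map_prod, hC, ren_X, Prod.smul_mk, Perm.smul_def, hg_fix σ hσ]
    exact Equiv.sum_comp σ (fun b => (∑ a : Fin n, (X (a, b) : MvPolynomial (Fin n × Fin n) ℂ)) ^ γ (Sum.inr ()) *
      ∏ i : Fin k, (X (g i, b) : MvPolynomial (Fin n × Fin n) ℂ) ^ γ (Sum.inl i))
  refine ⟨hfix, ?_⟩
  have hcard : (Finset.univ.image g).card ≤ k + 2 :=
    (Finset.card_image_le.trans (by rw [Finset.card_univ, Fintype.card_fin])).trans (by omega)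
  refine exists_supported_sum (k := k + 2) Finset.univ
    (fun b => (∑ a : Fin n, (X (a, b) : MvPolynomial (Fin n × Fin n) ℂ)) ^ γ (Sum.inr ()) *
      ∏ i : Fin k, (X (g i, b) : MvPolynomial (Fin n × Fin n) ℂ) ^ γ (Sum.inl i)) (fun b _ => ?_)
    (Finset.univ.image g) hcard hfix
  have hA : (insert b (Finset.univ.image g)).card ≤ k + 2 := by
    refine (Finset.card_insert_le _ _).trans ?_
    have := Finset.card_image_le (s := (Finset.univ : Finset (Fin k))) (f := g)
    rw [Finset.card_univ, Fintype.card_fin] at this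
    omega
  -- generators: the column sum `C_b` and the entries `x_{g(i) b}`
  have h := exists_supported_of_mem_adjoin (k := k + 2) (insert b (Finset.univ.image g)) hA
    (T := insert (∑ a : Fin n, (X (a, b) : MvPolynomial (Fin n × Fin n) ℂ))
      (Set.range fun i : Fin k => (X (g i, b) : MvPolynomial (Fin n × Fin n) ℂ)))
    (by
      intro t ht
      rcases ht with rfl | ⟨i, rfl⟩
      · obtain ⟨hCfix, hCder⟩ := colSum_supported_le (n := n) (K := k + 2) (by omega) b
        exact ⟨fun σ hσ => hCfix σ (hσ _ (Finset.mem_insert_self _ _)), hCder⟩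
      · refine ⟨fun σ hσ => ?_, X_supported_le (by omega) (g i, b)⟩
        have h1 : σ (g i) = g i := hσ _ (Finset.mem_insert_of_mem (Finset.mem_image_of_mem g (Finset.mem_univ i)))
        have h2 : σ b = b := hσ _ (Finset.mem_insert_self _ _)
        rw [ren_X]
        exact congrArg X (Prod.ext h1 h2))
    (p := (∑ a : Fin n, (X (a, b) : MvPolynomial (Fin n × Fin n) ℂ)) ^ γ (Sum.inr ()) *
      ∏ i : Fin k, (X (g i, b) : MvPolynomial (Fin n × Fin n) ℂ) ^ γ (Sum.inl i))
    (Subalgebra.mul_mem _ (Subalgebra.pow_mem _ (Algebra.subset_adjoin (Set.mem_insert _ _)) _)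
      (Subalgebra.prod_mem _ fun i _ => Subalgebra.pow_mem _
        (Algebra.subset_adjoin (Set.mem_insert_of_mem _ (Set.mem_range_self i))) _))
  exact h.2

/-- **Equivariant families in the augmented algebra have restorable orbit sums.** [folklore] -/
theorem qpOrbitRestorable_orbitSum_augmented {k : ℕ} (Φ : (Fin k → Fin n) → MvPolynomial (Fin n × Fin n) ℂ)
    (hmem : ∀ g, Φ g ∈ Algebra.adjoin ℂ (Set.range fun γ : Fin k ⊕ Unit → ℕ =>
      ∑ b : Fin n, (∑ a : Fin n, (X (a, b) : MvPolynomial (Fin n × Fin n) ℂ)) ^ γ (Sum.inr ()) *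
        ∏ i : Fin k, (X (g i, b) : MvPolynomial (Fin n × Fin n) ℂ) ^ γ (Sum.inl i)))
    (heq : ∀ (σ : Perm (Fin n)) (g : Fin k → Fin n), ren σ (Φ g) = Φ (σ ∘ g)) :
    QPOrbitRestorable (2 * k + 9) n (∑ g : Fin k → Fin n, Φ g) := by
  have hfix : ∀ σ : Perm (Fin n), ren σ (∑ g : Fin k → Fin n, Φ g) = ∑ g : Fin k → Fin n, Φ g := by
    intro σ
    rw [map_sum]
    simp only [heq]
    exact Fintype.sum_equiv ((Equiv.refl (Fin k)).arrowCongr (σ : Fin n ≃ Fin n)) (fun g => Φ (σ ∘ g)) Φ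
      (fun g => rfl)
  have hcard : ∀ g : Fin k → Fin n, (Finset.univ.image g).card ≤ k + 2 := fun g =>
    (Finset.card_image_le.trans (by rw [Finset.card_univ, Fintype.card_fin])).trans (by omega)
  have hsupp : ∀ g ∈ (Finset.univ : Finset (Fin k → Fin n)), ∃ 𝒟 : ValueDerivation ℂ (Fin n × Fin n), Φ g ∈ 𝒟.S ∧
      ∀ q ∈ 𝒟.S, ∃ T' : Finset (Fin n), T'.card ≤ k + 2 ∧ ∀ σ : Perm (Fin n), (∀ i ∈ T', σ i = i) → ren σ q = q :=
    fun g _ => (exists_supported_of_mem_adjoin (k := k + 2) (Finset.univ.image g) (hcard g)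
      (T := Set.range fun γ : Fin k ⊕ Unit → ℕ =>
        ∑ b : Fin n, (∑ a : Fin n, (X (a, b) : MvPolynomial (Fin n × Fin n) ℂ)) ^ γ (Sum.inr ()) *
          ∏ i : Fin k, (X (g i, b) : MvPolynomial (Fin n × Fin n) ℂ) ^ γ (Sum.inl i))
      (by rintro _ ⟨γ, rfl⟩; exact augmentedPowerSum_supported g γ) (hmem g)).2
  obtain ⟨𝒟, hmemD, hS⟩ := exists_supported_sum (k := k + 2) Finset.univ Φ hsupp ∅ (by simp) (fun σ _ => hfix σ)
  obtain ⟨G, inst, C, hC, hev, horb⟩ := ValueOrbit.qpOrbit_of_supportedDerivation 𝒟 hmemD hfix hS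
  refine ⟨G, inst, C, hC, hev, horb.trans ?_⟩
  have h1 : (n + 1) ^ (2 * (k + 2) + 4) = (n + 1) ^ (2 * k + 8) := by ring_nf
  have h2 := succ_pow_le_bound n (2 * k + 8)
  have h3 : 2 * k + 8 + 1 = 2 * k + 9 := by omega
  rw [h3] at h2
  rw [h1]
  exact h2

/-! ### Augmented column-symmetric patterns -/

/-- **Augmented column-symmetric patterns lie in the augmented algebra.**  If `Ψ ∈ ℂ[X_{(b,s)} : b < n, s ∈ Fin k ⊕ Unit]` is invariant
under permuting `b`, then `Ψ(X_{(b,inl i)} ↦ x_{g(i) b}, X_{(b,inr ⋆)} ↦ C_b) ∈ ℂ[A_γ(g) : γ]`. [cite: Weyl1939, Chap. II §3, Thm (2.3.A)] -/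
theorem aeval_mem_adjoin_augmented {k : ℕ} (g : Fin k → Fin n) (Ψ : MvPolynomial (Fin n × (Fin k ⊕ Unit)) ℂ)
    (hΨ : ∀ σ : Perm (Fin n), rename (fun w : Fin n × (Fin k ⊕ Unit) => (σ w.1, w.2)) Ψ = Ψ) :
    aeval (fun w : Fin n × (Fin k ⊕ Unit) => (Sum.elim (fun i : Fin k => (X (g i, w.1) : MvPolynomial (Fin n × Fin n) ℂ))
        (fun _ : Unit => ∑ a : Fin n, (X (a, w.1) : MvPolynomial (Fin n × Fin n) ℂ)) w.2)) Ψ ∈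
      Algebra.adjoin ℂ (Set.range fun γ : Fin k ⊕ Unit → ℕ =>
        ∑ b : Fin n, (∑ a : Fin n, (X (a, b) : MvPolynomial (Fin n × Fin n) ℂ)) ^ γ (Sum.inr ()) *
          ∏ i : Fin k, (X (g i, b) : MvPolynomial (Fin n × Fin n) ℂ) ^ γ (Sum.inl i)) := by
  have hmem := MultisymmetricPowerSums.mem_adjoin_powerSums_of_rowSymmetric_complex Ψ hΨ
  set ψ : MvPolynomial (Fin n × (Fin k ⊕ Unit)) ℂ →ₐ[ℂ] MvPolynomial (Fin n × Fin n) ℂ :=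
    aeval (fun w : Fin n × (Fin k ⊕ Unit) => (Sum.elim (fun i : Fin k => (X (g i, w.1) : MvPolynomial (Fin n × Fin n) ℂ))
        (fun _ : Unit => ∑ a : Fin n, (X (a, w.1) : MvPolynomial (Fin n × Fin n) ℂ)) w.2)) with hψ
  have hψgen : ψ '' (Set.range fun γ : Fin k ⊕ Unit → ℕ =>
      ∑ b : Fin n, ∏ s : Fin k ⊕ Unit, (X (b, s) : MvPolynomial (Fin n × (Fin k ⊕ Unit)) ℂ) ^ γ s) =
      Set.range fun γ : Fin k ⊕ Unit → ℕ =>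
        ∑ b : Fin n, (∑ a : Fin n, (X (a, b) : MvPolynomial (Fin n × Fin n) ℂ)) ^ γ (Sum.inr ()) *
          ∏ i : Fin k, (X (g i, b) : MvPolynomial (Fin n × Fin n) ℂ) ^ γ (Sum.inl i) := by
    rw [← Set.range_comp]
    refine congrArg Set.range (funext fun γ => ?_)
    simp only [Function.comp_apply, map_sum, map_prod, map_pow, hψ, aeval_X]
    refine Finset.sum_congr rfl fun b _ => ?_
    rw [Fintype.prod_sum_type]
    simp only [Sum.elim_inl, Sum.elim_inr, Finset.univ_unique, Finset.prod_singleton]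
    exact mul_comm _ _
  rw [← hψgen, Algebra.adjoin_image]
  exact Subalgebra.mem_map.mpr ⟨Ψ, hmem, rfl⟩

/-- Equivariance of the augmented evaluation. [folklore] -/
theorem ren_aeval_augmentedPattern {k : ℕ} (Ψ : MvPolynomial (Fin n × (Fin k ⊕ Unit)) ℂ)
    (hΨ : ∀ σ : Perm (Fin n), rename (fun w : Fin n × (Fin k ⊕ Unit) => (σ w.1, w.2)) Ψ = Ψ)
    (σ : Perm (Fin n)) (g : Fin k → Fin n) :
    ren σ (aeval (fun w : Fin n × (Fin k ⊕ Unit) => (Sum.elim (fun i : Fin k => (X (g i, w.1) : MvPolynomial (Fin n × Fin n) ℂ))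
        (fun _ : Unit => ∑ a : Fin n, (X (a, w.1) : MvPolynomial (Fin n × Fin n) ℂ)) w.2)) Ψ) =
      aeval (fun w : Fin n × (Fin k ⊕ Unit) => (Sum.elim (fun i : Fin k => (X ((σ ∘ g) i, w.1) : MvPolynomial (Fin n × Fin n) ℂ))
        (fun _ : Unit => ∑ a : Fin n, (X (a, w.1) : MvPolynomial (Fin n × Fin n) ℂ)) w.2)) Ψ := by
  have hC : ∀ b : Fin n, ren σ (∑ a : Fin n, (X (a, b) : MvPolynomial (Fin n × Fin n) ℂ)) = ∑ a : Fin n, X (a, σ b) := by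
    intro b
    rw [map_sum]
    simp only [ren_X, Prod.smul_mk, Perm.smul_def]
    exact Equiv.sum_comp σ (fun a => (X (a, σ b) : MvPolynomial (Fin n × Fin n) ℂ))
  rw [show ren σ (aeval (fun w : Fin n × (Fin k ⊕ Unit) => (Sum.elim (fun i : Fin k => (X (g i, w.1) : MvPolynomial (Fin n × Fin n) ℂ))
        (fun _ : Unit => ∑ a : Fin n, (X (a, w.1) : MvPolynomial (Fin n × Fin n) ℂ)) w.2)) Ψ) =
    ((ren σ).comp (aeval fun w : Fin n × (Fin k ⊕ Unit) => (Sum.elim (fun i : Fin k => (X (g i, w.1) : MvPolynomial (Fin n × Fin n) ℂ))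
        (fun _ : Unit => ∑ a : Fin n, (X (a, w.1) : MvPolynomial (Fin n × Fin n) ℂ)) w.2))) Ψ from rfl, comp_aeval]
  have hf : (fun w : Fin n × (Fin k ⊕ Unit) => (ren σ) ((Sum.elim (fun i : Fin k => (X (g i, w.1) : MvPolynomial (Fin n × Fin n) ℂ))
        (fun _ : Unit => ∑ a : Fin n, (X (a, w.1) : MvPolynomial (Fin n × Fin n) ℂ)) w.2))) =
      (fun w : Fin n × (Fin k ⊕ Unit) => (Sum.elim (fun i : Fin k => (X ((σ ∘ g) i, w.1) : MvPolynomial (Fin n × Fin n) ℂ))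
        (fun _ : Unit => ∑ a : Fin n, (X (a, w.1) : MvPolynomial (Fin n × Fin n) ℂ)) w.2)) ∘
        (fun w : Fin n × (Fin k ⊕ Unit) => (σ w.1, w.2)) := by
    funext w
    rcases w with ⟨b, s⟩
    rcases s with i | u
    · simp only [Sum.elim_inl, ren_X, Prod.smul_mk, Perm.smul_def, Function.comp_apply]
    · simp only [Sum.elim_inr, Function.comp_apply, hC]
  rw [hf, ← aeval_rename, hΨ]

/-- **ORBIT SUMS OF AUGMENTED COLUMN-SYMMETRIC `k`-ROW PATTERNS ARE RESTORABLE.**  For every column-symmetric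
`Ψ ∈ ℂ[X_{(b,s)} : b < n, s ∈ Fin k ⊕ Unit]`, `Σ_{g : Fin k → Fin n} Ψ(x_{g(i) b}, C_b)` is `QPOrbitRestorable (2k + 9) n`. [folklore] -/
theorem qpOrbitRestorable_orbitSum_augmentedPattern (k : ℕ) (Ψ : MvPolynomial (Fin n × (Fin k ⊕ Unit)) ℂ)
    (hΨ : ∀ σ : Perm (Fin n), rename (fun w : Fin n × (Fin k ⊕ Unit) => (σ w.1, w.2)) Ψ = Ψ) :
    QPOrbitRestorable (2 * k + 9) n
      (∑ g : Fin k → Fin n, aeval (fun w : Fin n × (Fin k ⊕ Unit) =>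
        (Sum.elim (fun i : Fin k => (X (g i, w.1) : MvPolynomial (Fin n × Fin n) ℂ))
          (fun _ : Unit => ∑ a : Fin n, (X (a, w.1) : MvPolynomial (Fin n × Fin n) ℂ)) w.2)) Ψ) :=
  qpOrbitRestorable_orbitSum_augmented _ (fun g => aeval_mem_adjoin_augmented g Ψ hΨ)
    (fun σ g => ren_aeval_augmentedPattern Ψ hΨ σ g)

end Summit.ValiantsHypothesis.ValiantsHypothesis.Theorems.MultiRowColumnProducts

end
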